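import Summits.HodgeConjecture.HodgeConjecture.Theorems.F0P3cStCharTSHsplitOfL2   -- ★ (S5) `hsplit_of_isSquareIntegrable` and its whole ★ cone: row 70 (F), 71-D, 71-d, 71-E, 71-G, N5, `Gqs`, `isCompact_center_Gqs`
import HarnessLib

/-!
# K2-LIT E3 · row #15 `K2E3KazhdanL2Orthonormal` · FILE A «CROSS-EXT-SPLIT»: every smooth extension `0 → r′ → E → r → 0` of two DISTINCT square-integrable
# irreducibles of `U(Φ₃)(L⁺_v)` (non-split `v`) SPLITS — the `hsplit₂` letter of ★ (X0′-NW) `innerG_char_cross_eq_zero_of_not_wild` at `L²` pairs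

Cell `pub/hodgecm-mathlib` (D-0151), Track B «K2-LIT» engine E3, socket item `stmt-HodgeConjecture-24833` (h413; lane `--supports … --as helper`);
seat `hodgecm-mathlib-K2E3-p15` (g0), SIGS-TABLE row #15 `sig_K2E3KazhdanL2Orthonormal` ([K] Thm K ∕ Prop. 12.6.1 (a): the `L²` characters are
orthonormal for `⟨ , ⟩_e`).  THEOREMS ONLY (no definition ∕ instance ∕ notation ∕ named fact ∕ `sorry`); ★-only imports.
Namespace `Summit.HodgeConjecture.HodgeConjecture.Cruxes.H413.K2E3KazhdanL2OrthonormalCrossExtSplit`.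

WHY.  The orthogonality half `⟨χ_π, χ_{π′}⟩_e = 0` (`π ≠ π′` both square-integrable) of row #15 is, at every NOT-WILD place, ONE call of the cell's
EXT-ROAD socket ★ `F0P3cStCharTSEPCrossNormZeroNotWild.innerG_char_cross_eq_zero_of_not_wild … r r′ hsplit₂ hHom0`
(`⟨χ_⟦r′⟧, χ_⟦r⟧⟩_e = Tr ⟦r′⟧(f_EP^r) = dim Hom_G(r, r′) − dim Ext¹(r, r′) = 0`), whose two letters are `hHom0 : Hom_G(r, r′) = 0` (★ HOM-ZERO
`SmoothIrrep.subsingleton_intertwiningMap_of_mk_ne_mk`) and `hsplit₂` — every SMOOTH extension of `r` BY `r′` splits.  The tree has `hsplit₂` only on the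
diagonal (★ (S5) `hsplit_of_isSquareIntegrable`, self-extensions of ONE `L²` class); this file proves it for TWO square-integrable classes.

THE MATHEMATICS (Casselman's criterion in `F`-rank one + the unitarity trick; no print letter).  `G = U(Φ₃)(L⁺_v)`, `Z = Z(G) ≅ E¹_v` COMPACT
(★ `isCompact_center_cmLocal_of_nonsplit`), `r`, `r′` irreducible smooth (hence admissible, ★ `isAdmissible_smoothIrrep`) with UNITARY central characters
`ω`, `ω′` (★ `exists_centralChar_norm_eq_one_of_nonsplit`), both square-integrable modulo `Z`; `0 → r′ —i→ E —p→ r → 0` smooth exact.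
* §1 (pure algebra, any group ∕ field) **CENTRAL SEPARATION**: if some central `z` acts on the SUB by the scalar `c₁` and on the QUOTIENT by `c₃ ≠ c₁`,
  then `T = ρ_E(z) − c₁` kills `i(r′) = ker p`, so `T = T̄ ∘ p` with `T̄ : r → E` equivariant and `p ∘ T̄ = (c₃ − c₁)·id`; `s = (c₃ − c₁)⁻¹ T̄` is an
  equivariant section (`exists_section_of_central_scalar_ne`).
* §2 **SAME CENTRAL CHARACTER** (`ω = ω′`): `E` is admissible (★ 71-G `IsAdmissible.of_exact`), `Z` acts on `E` by `ω` (★ 71-G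
  `forall_apply_eq_smul_of_exact_of_isCompact_center`), every normalised Jacquet exponent of `E` is one of `r′` or of `r` (★ 71-E
  `hasJacquetExponent_of_shortExact`), hence satisfies Casselman's strict inequality (★ N5 `u3SquareIntegrableExponents_holds` «⇒» at the square-integrable
  representatives), so `E` is `L²` modulo `Z` for every Haar measure (★ N5 «⇐») — `isSquareIntegrableModCenter_of_crossExtension`; then ★ 71-d (compact centre)
  and ★ row 70 (F) `Representation.selfExtension_splits_of_memLp_matrixCoeff` (all extensions `0 → σ → τ → σ′ → 0`, `σ`, `σ′` irreducible, `τ` admissible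
  with `L²` smooth coefficients, split) give the section.
* §3 **THE LETTER** `crossExtension_splits_of_isSquareIntegrable` = §1 ∨ §2 — the text of ★ (X0′-NW)'s `hsplit₂` VERBATIM at (`r` quotient, `r′` sub), both `L²`.
HONEST LABEL: count-neutral helper (`--supports`); row #15 itself stays OPEN (WILD `v` = [K] Thm K ∕ Track A row 21; HC boundedness = tier-0 stub 2);
HC_CM is proved only modulo the 7 printed citations (2 remaining named inputs hLiu418 = `stmt-HodgeConjecture-24832`, h413 = `stmt-HodgeConjecture-24833`)
until rung 0 closes; nothing printed is asserted here.

## References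
* [Casselman1995] W. Casselman, *Introduction to the theory of admissible representations of `p`-adic reductive groups* (draft 1 May 1995): §2.5
  Prop. 2.5.3–2.5.4 p. 29 (unitarity and complete reducibility of `L²`-mod-centre representations), Thm. 4.4.6 p. 45 (the exponent criterion).
* [BernsteinZelevinskyRMS1976] I. N. Bernstein, A. V. Zelevinsky, Russian Math. Surveys 31:3 (1976): 2.10–2.11 (central character), 2.44 p. 28.
* [SchneiderStuhler1997] P. Schneider, U. Stuhler, Publ. Math. IHÉS 85 (1997): §III.4 (`EP(π, π′)`; the Ext-vanishing this letter feeds).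
* [Rogawski1990] J. D. Rogawski, Ann. of Math. Stud. 123 (1990): §12.6 Prop. 12.6.1 (a)(b) p. 188.
-/

set_option autoImplicit false
-- the mandated namespace has the single-problem summit's repeated segment (`HodgeConjecture.HodgeConjecture`)
set_option linter.dupNamespace false

noncomputable section

open NumberField IsDedekindDomain MeasureTheory
open Literature.NumberTheory.Automorphic Literature.NumberTheory.Automorphic.UnitaryGroup Literature.NumberTheory.Rogawski1990
open scoped MatrixGroups

namespace Summit.HodgeConjecture.HodgeConjecture.Cruxes.H413.K2E3KazhdanL2OrthonormalCrossExtSplit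

open Summit.HodgeConjecture.HodgeConjecture.Cruxes.H413

/-! ## §1 Central separation: an extension whose ends carry DIFFERENT central scalars splits (pure algebra) -/

section CentralSeparation

variable {k G : Type*} [Field k] [Group G]
  {V₁ V₂ V₃ : Type*} [AddCommGroup V₁] [Module k V₁] [AddCommGroup V₂] [Module k V₂] [AddCommGroup V₃] [Module k V₃]
  {ρ₁ : Representation k G V₁} {ρ₂ : Representation k G V₂} {ρ₃ : Representation k G V₃}

/-- **CENTRAL SEPARATION.**  For representations `ρ₁ →f ρ₂ →g ρ₃` exact at `ρ₂` with `g` surjective and a CENTRAL `z ∈ G` acting on `ρ₁` by the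
scalar `c₁` and on `ρ₃` by the scalar `c₃ ≠ c₁`, the map `g` has an EQUIVARIANT SECTION: `T = ρ₂(z) − c₁` vanishes on `f(V₁) = ker g`, so it factors as
`T = T̄ ∘ g` with `T̄` equivariant (`z` central) and `g ∘ T̄ = (c₃ − c₁)·id`; take `s = (c₃ − c₁)⁻¹ T̄`.  (In particular `Ext¹(ρ₃, ρ₁) = 0` across distinct
central characters.) [cite: BernsteinZelevinskyRMS1976, 2.10–2.11] [cite: Casselman1995, §2.5 p. 28] -/
theorem exists_section_of_central_scalar_ne (f : ρ₁.IntertwiningMap ρ₂) (g : ρ₂.IntertwiningMap ρ₃)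
    (hfg : Function.Exact f g) (hg : Function.Surjective g) {z : G} (hz : z ∈ Subgroup.center G) {c₁ c₃ : k}
    (h₁ : ∀ x : V₁, ρ₁ z x = c₁ • x) (h₃ : ∀ y : V₃, ρ₃ z y = c₃ • y) (hne : c₁ ≠ c₃) :
    ∃ s : ρ₃.IntertwiningMap ρ₂, g.comp s = Representation.IntertwiningMap.id ρ₃ := by
  -- `T = ρ₂ z − c₁` kills `ker g = range f`
  set T : V₂ →ₗ[k] V₂ := (ρ₂ z : V₂ →ₗ[k] V₂) - c₁ • LinearMap.id with hT
  have hTapply : ∀ x : V₂, T x = ρ₂ z x - c₁ • x := fun x => by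
    simp only [hT, LinearMap.sub_apply, LinearMap.smul_apply, LinearMap.id_apply]
  have hTker : LinearMap.ker g.toLinearMap ≤ LinearMap.ker T := by
    intro x hx
    rw [LinearMap.mem_ker] at hx ⊢
    obtain ⟨y, rfl⟩ := (hfg x).1 hx
    rw [hTapply]
    have : ρ₂ z (f y) = f (ρ₁ z y) := (Representation.IntertwiningMap.isIntertwining _ _ f z y).symm
    rw [this, h₁, map_smul, sub_self]
  -- `T̄ : V₃ → V₂` with `T̄ (g x) = T x`
  set Tbar : V₃ →ₗ[k] V₂ :=
    ((LinearMap.ker g.toLinearMap).liftQ T hTker).comp (g.toLinearMap.quotKerEquivOfSurjective hg).symm.toLinearMap with hTbar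
  have hTbar_apply : ∀ x : V₂, Tbar (g x) = T x := fun x => by
    rw [hTbar, LinearMap.comp_apply, LinearEquiv.coe_toLinearMap, ← Representation.IntertwiningMap.toLinearMap_apply,
      LinearMap.quotKerEquivOfSurjective_symm_apply, Submodule.liftQ_apply]
  -- `T̄` is equivariant
  have hTbar_equiv : ∀ (h : G) (y : V₃), Tbar (ρ₃ h y) = ρ₂ h (Tbar y) := fun h y => by
    obtain ⟨x, rfl⟩ := hg y
    have e1 : ρ₃ h (g x) = g (ρ₂ h x) := (Representation.IntertwiningMap.isIntertwining _ _ g h x).symm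
    rw [e1, hTbar_apply, hTbar_apply, hTapply, hTapply, map_sub, map_smul]
    have hcomm : ρ₂ z (ρ₂ h x) = ρ₂ h (ρ₂ z x) := by
      rw [← Module.End.mul_apply, ← map_mul, ← Subgroup.mem_center_iff.1 hz h, map_mul, Module.End.mul_apply]
    rw [hcomm]
  -- `g ∘ T̄ = (c₃ − c₁) · id`
  have hgTbar : ∀ y : V₃, g (Tbar y) = (c₃ - c₁) • y := fun y => by
    obtain ⟨x, rfl⟩ := hg y
    rw [hTbar_apply, hTapply, map_sub, map_smul, Representation.IntertwiningMap.isIntertwining _ _ g z x, h₃, sub_smul]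
  have hc : c₃ - c₁ ≠ 0 := sub_ne_zero.2 (Ne.symm hne)
  refine ⟨⟨(c₃ - c₁)⁻¹ • Tbar, fun h => ?_⟩, ?_⟩
  · apply LinearMap.ext
    intro y
    simp only [LinearMap.comp_apply, LinearMap.smul_apply]
    rw [hTbar_equiv, map_smul]
  · apply Representation.IntertwiningMap.ext
    apply LinearMap.ext
    intro y
    rw [Representation.IntertwiningMap.comp_toLinearMap, LinearMap.comp_apply, Representation.IntertwiningMap.toLinearMap_id,
      LinearMap.id_apply]
    show g (((c₃ - c₁)⁻¹ • Tbar) y) = y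
    rw [LinearMap.smul_apply, map_smul, hgTbar, smul_smul, inv_mul_cancel₀ hc, one_smul]

end CentralSeparation

/-! ## §2 Same central character: the middle term of `0 → r′ → E → r → 0` (both ends `L²`) is admissible and `L²` modulo the centre -/

section Gqs

variable (L : Type) [Field L] [NumberField L] [IsCMField L] (v : HeightOneSpectrum (𝓞 ↥(maximalRealSubfield L)))

set_option maxHeartbeats 4000000 in
set_option synthInstance.maxHeartbeats 400000 in
-- budget: ★ N5's statement is read at the literal CM carrier (`Gqs L v` unfolds to `↥(unitaryGroupOfForm …)` by `rfl` only; class of ★ 71-D)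
/-- **CROSS 71-D.**  At a NON-SPLIT place `v`, for a Haar measure `μZ` on `G ⧸ Z(G)` (`G = U(Φ₃)(L⁺_v)`), two irreducible smooth `r′` (sub) and `r` (quotient)
whose classes are square-integrable modulo the centre, and a smooth exact `0 → r′.ρ —i→ ρE —p→ r.ρ → 0` on which the centre acts through ONE character `ω`
(the common central character; §1 disposes of the other case): `ρE` is admissible and `ρE.IsSquareIntegrableModCenter μZ′` for EVERY Haar `μZ′` on `G ⧸ Z(G)`.
Casselman's criterion ★ N5 both ways: every normalised Jacquet exponent of `ρE` is an exponent of `r′` or of `r` (★ 71-E), transported to the square-integrable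
representatives along the class isomorphisms (★ `HasJacquetExponent.map_of_injective` ∘ ★ `jacquetMap_injective`), where «⇒» bounds it; then «⇐» at `ρE`.
[cite: Casselman1995, Thm. 4.4.6 p. 45; §2.5 p. 28] [cite: Rogawski1990, §12.6 Prop. 12.6.1 p. 188] -/
theorem isSquareIntegrableModCenter_of_crossExtension (hns : ∀ w : PlacesOver L v, IsCMField.complexConj L • w.1 = w.1)
    [mG : MeasurableSpace (Gqs L v ⧸ Subgroup.center (Gqs L v))] [bG : BorelSpace (Gqs L v ⧸ Subgroup.center (Gqs L v))]
    (μZ : Measure (Gqs L v ⧸ Subgroup.center (Gqs L v))) [hμZ : μZ.IsHaarMeasure]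
    (r r' : SmoothIrrep (Gqs L v)) (hL2 : (IrrClass.mk r).IsSquareIntegrable μZ) (hL2' : (IrrClass.mk r').IsSquareIntegrable μZ)
    {E : Type} [AddCommGroup E] [Module ℂ E] (ρE : Representation ℂ (Gqs L v) E) (hE : ρE.IsSmooth)
    (i : r'.ρ.IntertwiningMap ρE) (p : ρE.IntertwiningMap r.ρ) (hi : Function.Injective i)
    (hker : LinearMap.ker p.toLinearMap = LinearMap.range i.toLinearMap) (hp : Function.Surjective p)
    (ω : ↥(Subgroup.center (Gqs L v)) →* ℂˣ)
    (hωE : ∀ (z : ↥(Subgroup.center (Gqs L v))) (x : E), ρE (z : Gqs L v) x = ((ω z : ℂˣ) : ℂ) • x) (hω1 : ∀ z, ‖((ω z : ℂˣ) : ℂ)‖ = 1) :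
    ρE.IsAdmissible ∧ ∀ (μZ' : Measure (Gqs L v ⧸ Subgroup.center (Gqs L v))) [μZ'.IsHaarMeasure], ρE.IsSquareIntegrableModCenter μZ' := by
  have hr : r.ρ.IsAdmissible := F0P3cStCharTSScTracePackage.isAdmissible_smoothIrrep L v hns r
  have hr' : r'.ρ.IsAdmissible := F0P3cStCharTSScTracePackage.isAdmissible_smoothIrrep L v hns r'
  have hexact : Function.Exact i p := LinearMap.exact_iff.2 hker
  -- (1) admissibility of the middle term
  have hadm : ρE.IsAdmissible := Representation.IsAdmissible.of_exact hr' hr hE i p hi hexact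
  refine ⟨hadm, fun μZ' hμZ' => ?_⟩
  -- (2) Casselman's criterion, both ways
  haveI := locallyCompactSpace_cmBorelU L 3 v
  have hN := isLimitOfCompactOpen_cmBorelTriple_N L 3 v
  have N5 := (U3SquareIntegrableExponents_iff L).1 (F0P3U3SquareIntegrableExponentsHolds.u3SquareIntegrableExponents_holds L)
  -- «⇒» at the square-integrable representatives of the two classes
  obtain ⟨r₀, hr₀r, hr₀L2⟩ := hL2
  obtain ⟨r₀', hr₀'r, hr₀'L2⟩ := hL2'
  have hr₀ : r₀.ρ.IsAdmissible := F0P3cStCharTSScTracePackage.isAdmissible_smoothIrrep L v hns r₀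
  have hr₀' : r₀'.ρ.IsAdmissible := F0P3cStCharTSScTracePackage.isAdmissible_smoothIrrep L v hns r₀'
  obtain ⟨ω₀, hω₀, hω₀1⟩ := @F0P3bCentralCharacterUnitaryNonsplit.exists_centralChar_norm_eq_one_of_nonsplit L _ _ _ 3 v hns r₀.V _ _ r₀.ρ
    r₀.isIrreducible hr₀
  obtain ⟨ω₀', hω₀', hω₀'1⟩ := @F0P3bCentralCharacterUnitaryNonsplit.exists_centralChar_norm_eq_one_of_nonsplit L _ _ _ 3 v hns r₀'.V _ _ r₀'.ρ
    r₀'.isIrreducible hr₀'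
  obtain ⟨e⟩ := (IrrClass.mk_eq_mk_iff r₀ r).1 hr₀r
  obtain ⟨e'⟩ := (IrrClass.mk_eq_mk_iff r₀' r').1 hr₀'r
  have hbound := ((@N5 v hns mG bG μZ hμZ r₀.V _ _ r₀.ρ hr₀ ω₀ hω₀).1 ⟨hω₀1, hr₀L2⟩).2
  have hbound' := ((@N5 v hns mG bG μZ hμZ r₀'.V _ _ r₀'.ρ hr₀' ω₀' hω₀').1 ⟨hω₀'1, hr₀'L2⟩).2
  -- «⇐» at `ρE`
  refine ((@N5 v hns mG bG μZ' hμZ' E _ _ ρE hadm ω hωE).2 ⟨hω1, fun χ' hχ' a ha0 ha1 hlt => ?_⟩).2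
  -- an exponent of `ρE` is an exponent of `r′` (sub) or of `r` (quotient)
  rcases Representation.hasJacquetExponent_of_shortExact (cmBorelTriple L 3 v) hN hE i p hi hexact hp hχ' with h | h
  · have hsymm_inj : Function.Injective e'.symm.toIntertwiningMap := fun a b hab => e'.symm.injective hab
    have hexp : r₀'.ρ.HasJacquetExponent (cmBorelTriple L 3 v) χ' :=
      h.map_of_injective (cmBorelTriple L 3 v) e'.symm.toIntertwiningMap
        (Representation.jacquetMap_injective (cmBorelTriple L 3 v) hN r₀'.isSmooth e'.symm.toIntertwiningMap hsymm_inj)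
    exact hbound' χ' hexp a ha0 ha1 hlt
  · have hsymm_inj : Function.Injective e.symm.toIntertwiningMap := fun a b hab => e.symm.injective hab
    have hexp : r₀.ρ.HasJacquetExponent (cmBorelTriple L 3 v) χ' :=
      h.map_of_injective (cmBorelTriple L 3 v) e.symm.toIntertwiningMap
        (Representation.jacquetMap_injective (cmBorelTriple L 3 v) hN r₀.isSmooth e.symm.toIntertwiningMap hsymm_inj)
    exact hbound χ' hexp a ha0 ha1 hlt

/-! ## §3 THE LETTER `hsplit₂` OF ★ (X0′-NW) AT TWO SQUARE-INTEGRABLE CLASSES -/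

set_option maxHeartbeats 4000000 in
set_option synthInstance.maxHeartbeats 400000 in
-- budget: as §2 (the literal CM carrier of `Gqs L v`)
/-- **CROSS-EXT-SPLIT — every smooth extension `0 → r′.ρ —i→ ρE —p→ r.ρ → 0` of two square-integrable irreducible smooth representations of
`U(Φ₃)(L⁺_v)` (`v` non-split) SPLITS.**  Binders after `hL2 hL2'` = the `hsplit₂` letter of ★ (X0′-NW)
`F0P3cStCharTSEPCrossNormZeroNotWild.innerG_char_cross_eq_zero_of_not_wild` VERBATIM (`r` the quotient, `r′` the sub).  Proof: `Z(G)` is compact and acts on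
`r′`, `r` through unitary characters `ω′`, `ω`; if `ω′ z ≠ ω z` for some central `z`, §1 `exists_section_of_central_scalar_ne`; otherwise the centre acts on
`ρE` through `ω` (★ 71-G), §2 makes `ρE` admissible and `L²` modulo the centre, ★ 71-d pulls the `L²` domination back to a Haar measure on `G`
(compact centre ★ `isCompact_center_Gqs`), and ★ row 70 (F) `Representation.selfExtension_splits_of_memLp_matrixCoeff` splits the extension.  With ★ (S5)
(the diagonal `r = r′`) this is `Ext¹_G(π, π′) = 0` for ALL pairs of square-integrable classes — the input of [SchneiderStuhler1997 §III.4]'s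
`⟨χ_π, χ_{π′}⟩_e = EP(π, π′) = δ_{π,π′}` that row #15 consumes at the not-wild places.
[cite: Casselman1995, §2.5 Prop. 2.5.3–2.5.4 p. 29 and Thm. 4.4.6] [cite: SchneiderStuhler1997, §III.4] [cite: Rogawski1990, §12.6 Prop. 12.6.1 (a) p. 188] -/
theorem crossExtension_splits_of_isSquareIntegrable (hns : ∀ w : PlacesOver L v, IsCMField.complexConj L • w.1 = w.1)
    [MeasurableSpace (Gqs L v ⧸ Subgroup.center (Gqs L v))] [BorelSpace (Gqs L v ⧸ Subgroup.center (Gqs L v))]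
    (μZ : Measure (Gqs L v ⧸ Subgroup.center (Gqs L v))) [μZ.IsHaarMeasure]
    (r r' : SmoothIrrep (Gqs L v)) (hL2 : (IrrClass.mk r).IsSquareIntegrable μZ) (hL2' : (IrrClass.mk r').IsSquareIntegrable μZ) :
    ∀ (E : Type) [AddCommGroup E] [Module ℂ E] (ρE : Representation ℂ (Gqs L v) E), ρE.IsSmooth →
      ∀ (i : r'.ρ.IntertwiningMap ρE) (p : ρE.IntertwiningMap r.ρ), Function.Injective i → LinearMap.ker p.toLinearMap = LinearMap.range i.toLinearMap →
        Function.Surjective p → ∃ s : r.ρ.IntertwiningMap ρE, p.comp s = Representation.IntertwiningMap.id r.ρ := by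
  intro E _ _ ρE hE i p hi hker hp
  have hr : r.ρ.IsAdmissible := F0P3cStCharTSScTracePackage.isAdmissible_smoothIrrep L v hns r
  have hr' : r'.ρ.IsAdmissible := F0P3cStCharTSScTracePackage.isAdmissible_smoothIrrep L v hns r'
  have hexact : Function.Exact i p := LinearMap.exact_iff.2 hker
  -- the unitary central characters of the two ends; the centre is compact at a non-split place
  obtain ⟨ω, hω, hω1⟩ := @F0P3bCentralCharacterUnitaryNonsplit.exists_centralChar_norm_eq_one_of_nonsplit L _ _ _ 3 v hns r.V _ _ r.ρ
    r.isIrreducible hr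
  obtain ⟨ω', hω', -⟩ := @F0P3bCentralCharacterUnitaryNonsplit.exists_centralChar_norm_eq_one_of_nonsplit L _ _ _ 3 v hns r'.V _ _ r'.ρ
    r'.isIrreducible hr'
  have hZ := F0P3bCentralCharacterUnitaryNonsplit.isCompact_center_cmLocal_of_nonsplit L 3 v hns
  by_cases hωω : ∀ z : ↥(Subgroup.center (Gqs L v)), ((ω' z : ℂˣ) : ℂ) = ((ω z : ℂˣ) : ℂ)
  · -- SAME central character: §2 + ★ 71-d + ★ row 70 (F)
    have hω'' : ∀ (z : ↥(Subgroup.center (Gqs L v))) (x : r'.V), r'.ρ (z : Gqs L v) x = ((ω z : ℂˣ) : ℂ) • x := fun z x =>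
      (hω' z x).trans (congrArg (fun c : ℂ => c • x) (hωω z))
    have hωE : ∀ (z : ↥(Subgroup.center (Gqs L v))) (x : E), ρE (z : Gqs L v) x = ((ω z : ℂˣ) : ℂ) • x :=
      Representation.forall_apply_eq_smul_of_exact_of_isCompact_center hZ hE i p hexact ω hω'' hω
    obtain ⟨hadm, hL2E⟩ := isSquareIntegrableModCenter_of_crossExtension L v hns μZ r r' hL2 hL2' ρE hE i p hi hker hp ω hωE hω1
    -- a Haar measure on `G`, right-invariant by unimodularity, charging open sets
    borelize (Gqs L v)
    set μG : Measure (Gqs L v) := Measure.haar with hμG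
    haveI : μG.IsMulRightInvariant := isMulRightInvariant_cmDatum_local_antidiagOne L 3 v μG
    -- a compact open subgroup (`G` non-archimedean)
    haveI : NonarchimedeanGroup (Gqs L v) := F0P3cStCharTSScTracePackage.nonarchimedeanGroup_Gqs L v
    obtain ⟨K₀, hK₀c⟩ := exists_isCompact_openSubgroup (G := Gqs L v)
    -- the `L²` smooth coefficients of `ρE` on `G` (compact centre pull-back ★ 71-d)
    have hL2G : ∀ φ ∈ ρE.contragredient, ∀ x : E, MemLp (ρE.matrixCoeff φ x) 2 μG := fun φ hφ x =>
      Representation.memLp_matrixCoeff_of_forall_isSquareIntegrableModCenter (F0P3cStCharTSParField.isCompact_center_Gqs L v hns) μG hE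
        hL2E hφ x
    exact Representation.selfExtension_splits_of_memLp_matrixCoeff μG r'.ρ ρE r.ρ hadm ⟨(K₀ : Subgroup (Gqs L v)), K₀.isOpen, hK₀c⟩ hL2G i p hi hker hp
  · -- DIFFERENT central characters: §1
    push Not at hωω
    obtain ⟨z, hz⟩ := hωω
    exact exists_section_of_central_scalar_ne i p hexact hp z.2 (fun x => hω' z x) (fun y => hω z y) hz

end Gqs

end Summit.HodgeConjecture.HodgeConjecture.Cruxes.H413.K2E3KazhdanL2OrthonormalCrossExtSplit

end
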